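import Summits.RiemannHypothesis.RiemannHypothesis.Theorems.WeilFormatCCinfRowMonomials
import Summits.RiemannHypothesis.RiemannHypothesis.Theorems.WeilFormatCPolyWindowEntryBox
import HarnessLib

/-!
# Format C, design C∞ (E2, data side): kernel boxes for the ROW REMAINDER constants `ρ^±(i, m₀)`

Route context: Fourier–Galerkin / Schur-complement certificates of Weil positivity on a window ("format C", C∞ door;
cell memo `run/shared/lean/pub/rh-explicit/rh-explicit-weil-2/gen15/E2-PLAN-v2.md` §5; supporting stmt-RiemannHypothesis-0098;
seat rh-explicit-weil-2).  `abs_evenRow/oddRow_sub_collected_le` (weil-10) bound the row truncation by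
`ρ⁺(i,m₀) = (remS(m₀)/π)Σ_{j<J} i^{2j}/m₀^{2j+1} + (2(π/4 + ΣΛ(n)n^{−1/2} + a(1+ρ(2a))/π)i^{2J}/π + (4/a)s²qq^{J+1}c_i)/m₀^{2J+1}`,
`ρ⁻(i,m₀) = (remS(m₀)/π)Σ_{j<J} i^{2j+1}/m₀^{2j+2} + (2(…)i^{2J}/π + (4/π)s²qq^{J}d_i)/m₀^{2J+1}`.
The door's `ρrowe`/`ρrowo` data may be ANY numbers dominating these; the generator therefore needs certified upper ends,
which this file provides as boxes from INPUT boxes: `RemS ∋ remS(m₀)` (`CinfCoeff.remSBox`), `P ∋ π`, `Pinv ∋ 1/π`,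
`Lam ∋ Σ_{n∈P(a)} Λ(n)n^{−1/2}`, `Rho ∋ ρ(2a) = weilArchDensity(2a)`, `S2 ∋ s²`, `QQ ∋ a²/(4π²)`, `Ci ∋ c_i` resp. `d_i`
(VERBATIM expressions; `mem_evenRowRemBox`, `mem_oddRowRemBox`).  Interval plumbing only; standard axioms; no RH claim.
-/

set_option autoImplicit false
-- `Summit.RiemannHypothesis.RiemannHypothesis.…` is the layout-mandated namespace (summit = problem name).
set_option linter.dupNamespace false

open Finset Complex
open scoped Real ArithmeticFunction.vonMangoldt

namespace Summit.RiemannHypothesis.RiemannHypothesis.Theorems.WeilFormatC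

open Literature.NumberTheory.LFunctions Literature.NumberTheory.LFunctions.Yoshida1992 Literature.Analysis.SpecialFunctions
open Literature.Analysis.ValidatedNumerics Literature.Analysis.ValidatedNumerics.NumericsMP

namespace CinfCoeff

open WinConst (ratBox mem_ratBox mulRatBox mem_mulRatBox)
open WinEntry (sumBox mem_sumBox)

variable {S : ℕ}

/-- `x^n` by repeated outward multiplication (local copy). -/
def powM (S : ℕ) (X : MI) : ℕ → MI
  | 0 => MI.ofInt S 1
  | n + 1 => (powM S X n).mul S X

/-- `powM ∋ x^n`. -/
theorem mem_powM (hS : 0 < S) {x : ℝ} {X : MI} (hx : MI.mem S x X) : ∀ n : ℕ, MI.mem S (x ^ n) (powM S X n)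
  | 0 => by simpa [powM] using MI.mem_ofInt S 1
  | n + 1 => by rw [pow_succ, powM]; exact MI.mem_mul hS (mem_powM hS hx n) hx

/-- `Σ_{j<J} i^{e j}/m₀^{f j}` as an exact rational for exponent maps `e`, `f`. -/
def geomQ (i m₀ J : ℕ) (e f : ℕ → ℕ) : ℚ := ∑ j ∈ Finset.range J, (i : ℚ) ^ e j / (m₀ : ℚ) ^ f j

/-- The bracket `2(π/4 + Λ-sum + a(1+ρ(2a))/π)` box. -/
def headBox (S : ℕ) (P Pinv Lam Rho : MI) (a : ℚ) : MI :=
  (((P.divNat 4).add Lam).add (mulRatBox (((MI.ofInt S 1).add Rho).mul S Pinv) a)).mulInt 2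

/-- `headBox ∋ 2(π/4 + ΣΛ/√n + a(1+ρ(2a))/π)`. -/
theorem mem_headBox (hS : 0 < S) {P Pinv Lam Rho : MI} (hP : MI.mem S Real.pi P) (hPinv : MI.mem S (1 / Real.pi) Pinv)
    {lam rho : ℝ} (hLam : MI.mem S lam Lam) (hRho : MI.mem S rho Rho) (a : ℚ) :
    MI.mem S (2 * (π / 4 + lam + (a : ℝ) * (1 + rho) / π)) (headBox S P Pinv Lam Rho a) := by
  have h1 : MI.mem S ((1 + rho) * (1 / Real.pi) * (a : ℚ)) (mulRatBox (((MI.ofInt S 1).add Rho).mul S Pinv) a) := by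
    have := mem_mulRatBox (MI.mem_mul hS (MI.mem_add (MI.mem_ofInt S 1) hRho) hPinv) a
    simpa using this
  have h := MI.mem_mulInt (MI.mem_add (MI.mem_add (MI.mem_divNat hP (n := 4) (by norm_num)) hLam) h1) 2
  rw [headBox]
  convert h using 1
  push_cast
  field_simp

/-- **Even row remainder box** `ρ⁺(i,m₀)`. -/
def evenRowRemBox (S : ℕ) (RemS P Pinv Lam Rho S2 QQ Ci : MI) (a : ℚ) (i m₀ J : ℕ) : MI :=
  (mulRatBox (RemS.mul S Pinv) (geomQ i m₀ J (fun j ↦ 2 * j) (fun j ↦ 2 * j + 1))).add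
    (mulRatBox ((mulRatBox ((headBox S P Pinv Lam Rho a).mul S Pinv) ((i : ℚ) ^ (2 * J))).add
      (mulRatBox ((S2.mul S (powM S QQ (J + 1))).mul S Ci) (4 / a))) (1 / (m₀ : ℚ) ^ (2 * J + 1)))

/-- **`evenRowRemBox ∋ ρ⁺(i,m₀)`** (verbatim the remainder constant of `abs_evenRow_sub_collected_le` without the factor
`(m₀/m)^{E+1}`). -/
theorem mem_evenRowRemBox (hS : 0 < S) {a : ℚ} (ha : 0 < a) {i m₀ : ℕ} (hm₀ : 0 < m₀) (J : ℕ)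
    {RemS P Pinv Lam Rho S2 QQ Ci : MI} {remS : ℝ} (hRemS : MI.mem S remS RemS) (hP : MI.mem S Real.pi P)
    (hPinv : MI.mem S (1 / Real.pi) Pinv)
    (hLam : MI.mem S (∑ k ∈ weilPrimeIndex (a : ℝ), (Λ k : ℝ) / Real.sqrt k) Lam)
    (hRho : MI.mem S (weilArchDensity (2 * (a : ℝ))) Rho)
    (hS2 : MI.mem S ((Real.exp ((a : ℝ) / 2) - Real.exp (-((a : ℝ) / 2))) ^ 2) S2)
    (hQQ : MI.mem S ((a : ℝ) ^ 2 / (4 * Real.pi ^ 2)) QQ) (hCi : MI.mem S (1 / (1 + 4 * freq (a : ℝ) i ^ 2)) Ci) :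
    MI.mem S
      (remS / π * ∑ j ∈ Finset.range J, (i : ℝ) ^ (2 * j) / (m₀ : ℝ) ^ (2 * j + 1)
        + (2 * (π / 4 + (∑ k ∈ weilPrimeIndex (a : ℝ), (Λ k : ℝ) / Real.sqrt k) + (a : ℝ) * (1 + weilArchDensity (2 * (a : ℝ))) / π)
              * (i : ℝ) ^ (2 * J) / π
            + 4 / (a : ℝ) * (Real.exp ((a : ℝ) / 2) - Real.exp (-((a : ℝ) / 2))) ^ 2 * ((a : ℝ) ^ 2 / (4 * π ^ 2)) ^ (J + 1)
              * (1 / (1 + 4 * freq (a : ℝ) i ^ 2))) / (m₀ : ℝ) ^ (2 * J + 1))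
      (evenRowRemBox S RemS P Pinv Lam Rho S2 QQ Ci a i m₀ J) := by
  have hπ : Real.pi ≠ 0 := Real.pi_ne_zero
  have hm' : (m₀ : ℝ) ≠ 0 := by exact_mod_cast hm₀.ne'
  have ha' : (a : ℝ) ≠ 0 := by exact_mod_cast ha.ne'
  have h1 := mem_mulRatBox (MI.mem_mul hS hRemS hPinv) (geomQ i m₀ J (fun j ↦ 2 * j) (fun j ↦ 2 * j + 1))
  have hH := mem_headBox hS hP hPinv hLam hRho a
  have h2 := mem_mulRatBox (MI.mem_mul hS hH hPinv) ((i : ℚ) ^ (2 * J))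
  have h3 := mem_mulRatBox (MI.mem_mul hS (MI.mem_mul hS hS2 (mem_powM hS hQQ (J + 1))) hCi) (4 / a)
  have h := MI.mem_add h1 (mem_mulRatBox (MI.mem_add h2 h3) (1 / (m₀ : ℚ) ^ (2 * J + 1)))
  rw [evenRowRemBox]
  convert h using 1
  rw [geomQ]; push_cast
  field_simp

/-- **Odd row remainder box** `ρ⁻(i,m₀)` (`Ci ∋ d_i = ω_i/(1+4ω_i²)` here). -/
def oddRowRemBox (S : ℕ) (RemS P Pinv Lam Rho S2 QQ Ci : MI) (a : ℚ) (i m₀ J : ℕ) : MI :=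
  (mulRatBox (RemS.mul S Pinv) (geomQ i m₀ J (fun j ↦ 2 * j + 1) (fun j ↦ 2 * j + 2))).add
    (mulRatBox ((mulRatBox ((headBox S P Pinv Lam Rho a).mul S Pinv) ((i : ℚ) ^ (2 * J))).add
      ((((S2.mul S Pinv).mul S (powM S QQ J)).mul S Ci).mulInt 4)) (1 / (m₀ : ℚ) ^ (2 * J + 1)))

/-- **`oddRowRemBox ∋ ρ⁻(i,m₀)`** (verbatim the remainder constant of `abs_oddRow_sub_collected_le`). -/
theorem mem_oddRowRemBox (hS : 0 < S) {a : ℚ} {i m₀ : ℕ} (hm₀ : 0 < m₀) (J : ℕ)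
    {RemS P Pinv Lam Rho S2 QQ Ci : MI} {remS : ℝ} (hRemS : MI.mem S remS RemS) (hP : MI.mem S Real.pi P)
    (hPinv : MI.mem S (1 / Real.pi) Pinv)
    (hLam : MI.mem S (∑ k ∈ weilPrimeIndex (a : ℝ), (Λ k : ℝ) / Real.sqrt k) Lam)
    (hRho : MI.mem S (weilArchDensity (2 * (a : ℝ))) Rho)
    (hS2 : MI.mem S ((Real.exp ((a : ℝ) / 2) - Real.exp (-((a : ℝ) / 2))) ^ 2) S2)
    (hQQ : MI.mem S ((a : ℝ) ^ 2 / (4 * Real.pi ^ 2)) QQ)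
    (hCi : MI.mem S (freq (a : ℝ) i / (1 + 4 * freq (a : ℝ) i ^ 2)) Ci) :
    MI.mem S
      (remS / π * ∑ j ∈ Finset.range J, (i : ℝ) ^ (2 * j + 1) / (m₀ : ℝ) ^ (2 * j + 2)
        + (2 * (π / 4 + (∑ k ∈ weilPrimeIndex (a : ℝ), (Λ k : ℝ) / Real.sqrt k) + (a : ℝ) * (1 + weilArchDensity (2 * (a : ℝ))) / π)
              * (i : ℝ) ^ (2 * J) / π
            + 4 * (Real.exp ((a : ℝ) / 2) - Real.exp (-((a : ℝ) / 2))) ^ 2 / π * ((a : ℝ) ^ 2 / (4 * π ^ 2)) ^ J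
              * (freq (a : ℝ) i / (1 + 4 * freq (a : ℝ) i ^ 2))) / (m₀ : ℝ) ^ (2 * J + 1))
      (oddRowRemBox S RemS P Pinv Lam Rho S2 QQ Ci a i m₀ J) := by
  have hπ : Real.pi ≠ 0 := Real.pi_ne_zero
  have hm' : (m₀ : ℝ) ≠ 0 := by exact_mod_cast hm₀.ne'
  set c : ℝ := freq (a : ℝ) i / (1 + 4 * freq (a : ℝ) i ^ 2) with hc
  have h1 := mem_mulRatBox (MI.mem_mul hS hRemS hPinv) (geomQ i m₀ J (fun j ↦ 2 * j + 1) (fun j ↦ 2 * j + 2))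
  have hH := mem_headBox hS hP hPinv hLam hRho a
  have h2 := mem_mulRatBox (MI.mem_mul hS hH hPinv) ((i : ℚ) ^ (2 * J))
  have h3 := MI.mem_mulInt (MI.mem_mul hS (MI.mem_mul hS (MI.mem_mul hS hS2 hPinv) (mem_powM hS hQQ J)) hCi) 4
  have h := MI.mem_add h1 (mem_mulRatBox (MI.mem_add h2 h3) (1 / (m₀ : ℚ) ^ (2 * J + 1)))
  rw [oddRowRemBox]
  convert h using 1
  rw [geomQ]; push_cast
  field_simp

end CinfCoeff

end Summit.RiemannHypothesis.RiemannHypothesis.Theorems.WeilFormatC
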